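import Mathlib.Topology.Homeomorph.Lemmas
import Mathlib.NumberTheory.Padics.ProperSpace
import Mathlib.Topology.MetricSpace.Ultra.TotallySeparated
import Literature.AnabelianGeometry.AbsoluteAnabelian.AbsTopIII.GeometricCyclotomeModule
import Literature.AnabelianGeometry.AbsoluteAnabelian.AbsTopIII.CyclotomeCohomologyTools
import HarnessLib

/-!
# [AbsTopIII] Prop. 1.4 (ii): a NONTRIVIAL intrinsic cyclotome `M(Ẑ) = Hom(H²(Δ, Ẑ), Ẑ)`, kernel-certified

Mochizuki, *Topics in Absolute Anabelian Geometry III*, §1, Prop. 1.4 (ii) p. 31 ("`M_X := Hom(H²(Δ_X, Ẑ), Ẑ)`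
[...] a natural isomorphism `I_x ≅ M_X`"), manuscript pagination (lit key `paper:url-5493eb38cbb7`).
PROOF-ONLY file (no definition), cell abc-iut, FACT-LIST row F-0378, seat abc-iut-f-085.

`GeometricCyclotome.lean` / `GeometricCyclotomeModule.lean` made the INTRINSIC cyclotome
`CyclotomeMod E Λ = Hom_ℤ(H²(Δ_E, Λ), Λ)` of an extension of profinite groups `1 → Δ → Π → G → 1` a real
object (Mathlib's continuous cohomology of the trivial `Δ`-module `Λ`).  Whether ANY such cyclotome is
nonzero was undecided in the tree (Mathlib computes no `H²`).  This file certifies one: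

* `CyclotomeMod.nontrivial_of_biadditive` — CRITERION: a continuous bi-additive pairing
  `χ : Δ × Δ → Λ` and commuting `x₀, y₀ ∈ Δ` with `χ(x₀,y₀) ≠ χ(y₀,x₀)` force `M_E(Λ) ≠ 0` (the
  alternation functional of `ContCohomologyTools.exists_H2_functional_of_trivial_action` is a nonzero
  element of `Hom(H²(Δ, Λ), Λ)`);
* `exists_cyclotomeMod_addChar` — for every profinite `Γ`, the split extension `Π = (Ẑ × Ẑ) × Γ ↠ Γ`
  (`Ẑ = ∏_p ℤ_p = ZHatCoeff`, pairing `χ((a,b),(a',b')) = a·b'`) has `M(Ẑ) ≠ 0`, and `((a,b),γ) ↦ a·m`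
  (`m ≠ 0`) is a continuous additive map `Π → M(Ẑ)` not vanishing on `Δ`;
* `exists_nontrivial_cyclotomeMod` — **for every profinite group `Γ` there is an extension with
  `gal = Γ` and NONTRIVIAL intrinsic cyclotome** (non-vacuity input for every schema row over `M_X`).

HONEST FRAMING: a statement about OUR typing of `M_X` at junk group-theoretic data (not a curve); nothing
here bears on [IUTchIII] Cor. 3.12.
-/

noncomputable section

namespace Literature.AnabelianGeometry.AbsoluteAnabelian.AbsTopIII

open CategoryTheory

/-! ### A nontrivial intrinsic cyclotome -/

section Cyclotome

universe u

variable (Λ : Type u) [AddCommGroup Λ] [TopologicalSpace Λ] [IsTopologicalAddGroup Λ]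

/-- **Criterion for a NONTRIVIAL intrinsic cyclotome `M_E(Λ) = Hom(H²(Δ_E, Λ), Λ)`.**  If `Δ_E`
carries a continuous bi-additive pairing `χ : Δ_E × Δ_E → Λ` and commuting elements `x₀, y₀` with
`χ(x₀, y₀) ≠ χ(y₀, x₀)`, then `M_E(Λ) ≠ 0`: the alternation functional of
`ContCohomologyTools.exists_H2_functional_of_trivial_action` is a `ℤ`-linear map `H²(Δ_E, Λ) → Λ`
taking the value `χ(x₀, y₀) - χ(y₀, x₀) ≠ 0` on the class of the cocycle `(x, y, z) ↦ χ(x⁻¹y, y⁻¹z)`.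
[cite: MochizukiAbsTopIII2015, Prop 1.4 (ii) p.31] -/
theorem CyclotomeMod.nontrivial_of_biadditive (E : FundamentalExtension.{u})
    (χ : C(E.geom × E.geom, Λ)) (hχ₁ : ∀ x y z, χ (x * y, z) = χ (x, z) + χ (y, z))
    (hχ₂ : ∀ x y z, χ (x, y * z) = χ (x, y) + χ (x, z)) (x₀ y₀ : E.geom)
    (hcomm : x₀ * y₀ = y₀ * x₀) (hne : χ (x₀, y₀) ≠ χ (y₀, x₀)) :
    Nontrivial (CyclotomeMod E Λ) := by
  obtain ⟨ξ, τ, hτ⟩ := ContCohomologyTools.exists_H2_functional_of_trivial_action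
    (geomTrivialRep E Λ) (fun _ _ => rfl) χ hχ₁ hχ₂ x₀ y₀ hcomm
  refine ⟨⟨CyclotomeMod.ofDual
    ((TopModuleCat.Hom.hom τ).toLinearMap : geomH2 E Λ →ₗ[ℤ] Λ), 0, ?_⟩⟩
  intro h
  have h' := congrArg (fun m : CyclotomeMod E Λ => m.toDual ξ) h
  change τ ξ = (0 : geomCyclotomeDual E Λ) ξ at h'
  rw [hτ, LinearMap.zero_apply, sub_eq_zero] at h'
  exact hne h'

/-- **An extension of profinite groups with a continuous additive map `Π → M(Ẑ)` into its intrinsic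
cyclotome that does not vanish on `Δ`.**  For every profinite group `Γ`, the extension
`1 → Δ → Π → Γ → 1` with `Π = (Ẑ × Ẑ) × Γ`, `Δ = Ẑ × Ẑ` (`Ẑ = ∏_p ℤ_p` the coefficient ring) has a
NONTRIVIAL intrinsic cyclotome `M(Ẑ) = Hom(H²(Δ, Ẑ), Ẑ)` ("`M_X := Hom(H²(Δ_X, Ẑ), Ẑ)`",
Prop. 1.4 (ii)) — by the bilinear pairing `χ((a,b),(a',b')) = a·b'` and
`CyclotomeMod.nontrivial_of_biadditive` — and, for `0 ≠ m ∈ M(Ẑ)`, the map `((a, b), γ) ↦ a · m` is a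
continuous additive map `Π → M(Ẑ)` with value `m ≠ 0` at `((1, 0), 1) ∈ Δ`.
[cite: MochizukiAbsTopIII2015, Prop 1.4 (ii) p.31] -/
theorem exists_cyclotomeMod_addChar (Γ : ProfiniteGrp.{u}) :
    ∃ (E : FundamentalExtension.{u}) (_ : E.gal = Γ) (φ : C(E.arith, CyclotomeMod E ZHatCoeff.{u})),
      (∀ x y, φ (x * y) = φ x + φ y) ∧ ∃ δ : E.geom, φ δ ≠ 0 := by
  haveI : T2Space (Multiplicative ZHatCoeff.{u}) := inferInstanceAs (T2Space ZHatCoeff.{u})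
  haveI : TotallyDisconnectedSpace ZHatCoeff.{u} :=
    (Homeomorph.ulift (X := ∀ p : Nat.Primes, @PadicInt (p : ℕ) ⟨p.2⟩)).symm.totallyDisconnectedSpace
  haveI : TotallyDisconnectedSpace (Multiplicative ZHatCoeff.{u}) :=
    inferInstanceAs (TotallyDisconnectedSpace ZHatCoeff.{u})
  let E : FundamentalExtension.{u} :=
    { arith := ProfiniteGrp.of ((Multiplicative ZHatCoeff.{u} × Multiplicative ZHatCoeff.{u}) × Γ)
      gal := Γ
      aug := ContinuousMonoidHom.snd (Multiplicative ZHatCoeff.{u} × Multiplicative ZHatCoeff.{u}) Γ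
      aug_surjective := fun g => ⟨(1, g), rfl⟩ }
  refine ⟨E, rfl, ?_⟩
  -- the projection `Π → Ẑ × Ẑ` and the bilinear pairing on `Δ`
  let pr' : E.arith →ₜ* (Multiplicative ZHatCoeff.{u} × Multiplicative ZHatCoeff.{u}) := ContinuousMonoidHom.fst (Multiplicative ZHatCoeff.{u} × Multiplicative ZHatCoeff.{u}) Γ
  let pr : E.geom →ₜ* (Multiplicative ZHatCoeff.{u} × Multiplicative ZHatCoeff.{u}) := pr'.comp (subgroupInclusion E.geom)
  have hpr : Continuous pr := pr.continuous
  let χ : C(E.geom × E.geom, ZHatCoeff.{u}) :=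
    ⟨fun q => Multiplicative.toAdd (pr q.1).1 * Multiplicative.toAdd (pr q.2).2,
      (continuous_toAdd.comp (continuous_fst.comp (hpr.comp continuous_fst))).mul
        (continuous_toAdd.comp (continuous_snd.comp (hpr.comp continuous_snd)))⟩
  have hχapp : ∀ x y : E.geom,
      χ (x, y) = Multiplicative.toAdd (pr x).1 * Multiplicative.toAdd (pr y).2 := fun _ _ => rfl
  let x₀ : E.geom := ⟨((Multiplicative.ofAdd 1, 1), 1), rfl⟩
  let y₀ : E.geom := ⟨((1, Multiplicative.ofAdd 1), 1), rfl⟩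
  have hx₀ : pr x₀ = (Multiplicative.ofAdd 1, 1) := rfl
  have hy₀ : pr y₀ = (1, Multiplicative.ofAdd 1) := rfl
  have hnt : Nontrivial (CyclotomeMod E ZHatCoeff.{u}) := by
    refine CyclotomeMod.nontrivial_of_biadditive ZHatCoeff.{u} E χ ?_ ?_ x₀ y₀ ?_ ?_
    · intro x y z
      simp only [hχapp, map_mul, Prod.fst_mul, toAdd_mul, add_mul]
    · intro x y z
      simp only [hχapp, map_mul, Prod.snd_mul, toAdd_mul, mul_add]
    · exact Subtype.ext (Prod.ext (Prod.ext (mul_comm _ _) (mul_comm _ _)) rfl)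
    · rw [hχapp, hχapp, hx₀, hy₀]
      change Multiplicative.toAdd (Multiplicative.ofAdd (1 : ZHatCoeff.{u})) *
          Multiplicative.toAdd (Multiplicative.ofAdd (1 : ZHatCoeff.{u})) ≠
        Multiplicative.toAdd (1 : Multiplicative ZHatCoeff.{u}) *
          Multiplicative.toAdd (1 : Multiplicative ZHatCoeff.{u})
      rw [toAdd_ofAdd, toAdd_one, mul_one, mul_zero]
      exact one_ne_zero
  obtain ⟨m, hm⟩ := exists_ne (0 : CyclotomeMod E ZHatCoeff.{u})
  -- the additive character `((a, b), γ) ↦ a · m`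
  let φ : C(E.arith, CyclotomeMod E ZHatCoeff.{u}) :=
    ⟨fun x => CyclotomeMod.ofDual (Multiplicative.toAdd (pr' x).1 • m.toDual), by
      refine continuous_induced_rng.2 (continuous_pi fun ξ => ?_)
      exact (continuous_toAdd.comp (continuous_fst.comp pr'.continuous)).mul continuous_const⟩
  have hφapp : ∀ x, φ x = CyclotomeMod.ofDual (Multiplicative.toAdd (pr' x).1 • m.toDual) :=
    fun _ => rfl
  refine ⟨φ, fun x y => ?_, ⟨((Multiplicative.ofAdd 1, 1), 1), rfl⟩, ?_⟩
  · rw [hφapp, hφapp, hφapp, map_mul, Prod.fst_mul, toAdd_mul, add_smul]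
    rfl
  · rw [hφapp]
    change CyclotomeMod.ofDual
      (Multiplicative.toAdd (Multiplicative.ofAdd (1 : ZHatCoeff.{u})) • m.toDual) ≠ 0
    rw [toAdd_ofAdd, one_smul]
    exact hm

/-- **The tree's first kernel-certified NONTRIVIAL intrinsic cyclotome**: for every profinite group
`Γ` there is an extension of profinite groups `1 → Δ → Π → Γ → 1` whose intrinsic cyclotome
`M(Ẑ) = Hom(H²(Δ, Ẑ), Ẑ)` ("`M_X := Hom(H²(Δ_X, Ẑ), Ẑ)`", Prop. 1.4 (ii) p. 31) is nontrivial
(`Δ = Ẑ × Ẑ`).  Non-vacuity input for every schema row quantifying over `M_X`.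
[cite: MochizukiAbsTopIII2015, Prop 1.4 (ii) p.31] -/
theorem exists_nontrivial_cyclotomeMod (Γ : ProfiniteGrp.{u}) :
    ∃ E : FundamentalExtension.{u}, E.gal = Γ ∧ Nontrivial (CyclotomeMod E ZHatCoeff.{u}) := by
  obtain ⟨E, hE, φ, -, δ, hδ⟩ := exists_cyclotomeMod_addChar Γ
  exact ⟨E, hE, ⟨φ δ, 0, hδ⟩⟩

end Cyclotome

end Literature.AnabelianGeometry.AbsoluteAnabelian.AbsTopIII
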